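import Summits.Ventures.LatticeQCDFlow.Scaling.SectorOfferCeiling
import Literature.Probability.MarkovChains.AsymptoticVarianceSpectral

/-!
HONEST FRAMING: exact (Metropolis-corrected) sampling algorithms for lattice gauge theory; figures
of merit are autocorrelation/cost numbers at stated couplings and volumes; no continuum-physics
claim.

# SectorIndicatorAutocorrelation — THE SECTOR INDICATOR OF A STARVED REPLICA IS A SLOW OBSERVABLE BY NAME: ITS DIRICHLET FORM IS
# `≤ (t·c_k/m)·μ_0(A)·μ_{k+1}(Aᶜ)` AGAINST ITS VARIANCE `μ_{k+1}(A)μ_{k+1}(Aᶜ)`, SO (MADRAS–SLADE PROP. 9.2.2, IN THE TREE)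
# `τ_int(𝟙_A∘x_{k+1}) ≥ m·μ_{k+1}(A)/(t·c_k·μ_0(A)) − ½ ≥ m/(t·c_k·p') − ½` — FOR EVERY HOT SAMPLER AND ALLOCATION (lean-2 GEN-29, ours)

Venture-side (OURS).  Cell `lqcd-flow` (pub-lqcd), unit `pub-lqcd-lean-2-g29`, 2026-08-28.  Chapter O, file 15: `Scaling/TightSectorAutocorrelationFloor`
(O9) exhibited the second eigenfunction as a slow observable; here the slow observable is NAMED — the (centred) indicator that replica `k+1` lies in the
sector `A` —, through the printed inequality `τ_int,g ≥ 1/(1 − ρ_g(1)) − ½` of Madras–Slade (Proposition 9.2.2, `Literature/…/AsymptoticVarianceSpectral`,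
Jensen on the spectral measure) with `1 − ρ_g(1) = 𝓔_P(g)/Var_π̃(g)` and the Dirichlet-form estimate behind `Scaling/SectorOfferCeiling` (O3):
`𝓔_P(g_k) ≤ (t·c_k/m)·μ_0(A)·μ_{k+1}(Aᶜ)` for the profile `g_k(x) = f_A^{μ_{k+1}}(x_{k+1})` of a sector-idle cold level, `Var_π̃(g_k) = μ_{k+1}(A)μ_{k+1}(Aᶜ)`.

## What is proved

* **`sectorProfile_dirichletForm_le`** — `𝓔_P(g_k) ≤ t·(c_k/m)·μ_0(A)·μ_{k+1}(Aᶜ)` (any `0 ≤ t ≤ 1`, probability vector `w`, kernels; level `k+1` sector-idle,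
  `A`-preserving maps).
* **`sectorProfile_tauInt_ge`** — irreducible scheme, reversible kernels, `μ_0(A) > 0`:
  **`v(g_k)/(2Var g_k) ≥ m·μ_{k+1}(A)/(t·c_k·μ_0(A)) − ½`**; **`tightSector_sectorProfile_tauInt_ge`** — tight sector: **`≥ m/(t·c_k·p') − ½`**;
  `dominatedStar_sectorProfile_tauInt_two_sided` — exact hot redraws, one-sided domination: the same `g_k` also obeys N3's ceiling
  `≤ 1/(p·min{ct/(3m),(1−t)w_0/(7K)}) − ½`.

Reading (no numerics implied): the topological-sector census of any single starved replica is an observable whose integrated autocorrelation time is at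
least `m/(t·c_k·p') − ½` in a map-assisted hub of pointwise-tight quality `p'` — whatever the hot sampler —, matching chapter N's ceiling up to `3ĉ/c`
and the quality ratio `p'/p`.  NOT CLAIMED: anything measured.  Literature grade (cell rule): OWN COROLLARY (O3's estimate + Madras–Slade Prop. 9.2.2 as
typed); nothing new cited as a fact; no new bib keys.
-/

noncomputable section

open Finset Function Matrix
open Literature.Probability.MarkovChains

namespace Summit.Ventures.LatticeQCDFlow.Scaling

variable {S : Type*} [Fintype S] [DecidableEq S] {K m : ℕ} {μ : Fin (K + 1) → S → ℝ} {M : Fin (K + 1) → S → S → ℝ}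
  {w : Fin (K + 1) → ℝ} {t p : ℝ}

section Star
variable (κ : Fin m → Fin K) (φ : Fin m → Equiv.Perm S)

/-- **`𝓔_P(g_k) ≤ t·(c_k/m)·μ_0(A)·μ_{k+1}(Aᶜ)`** for the sector profile `g_k(x) = Σ_i [i = k+1]·f_A^{μ_i}(x_i)` of a sector-idle cold level
(`A`-preserving maps; any `0 ≤ t ≤ 1`, probability vector `w`, `μ_j`-reversible kernels, `m ≥ 1`). [ours] -/
theorem sectorProfile_dirichletForm_le (hm : 1 ≤ m) (hμ : ∀ k x, 0 < μ k x) (hμ1 : ∀ k, ∑ u, μ k u = 1)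
    (hM : ∀ k, IsRowStochastic (M k)) (hMrev : ∀ k, DetailedBalance (μ k) (M k)) (hw0 : ∀ k, 0 ≤ w k) (hw1 : ∑ k, w k = 1)
    (ht0 : 0 ≤ t) (ht1 : t ≤ 1) {A : Finset S} (hφA : ∀ r u, φ r u ∈ A ↔ u ∈ A) (k : Fin K)
    (hidle : w k.succ * edgeMeasure (μ k.succ) (M k.succ) A Aᶜ = 0) :
    dirichletForm (tensorFun μ) (fun y z : Fin (K + 1) → S =>
        t * ptGraphSwap μ (fun r : Fin m => (((0 : Fin (K + 1)), (κ r).succ) : Fin (K + 1) × Fin (K + 1))) φ y z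
          + (1 - t) * prodKernel w M y z)
        (fun x => ∑ i, (if i = k.succ then (1 : ℝ) else 0) * bottleneckTestFun (μ i) A (x i))
      ≤ t * (((univ.filter (fun r : Fin m => κ r = k)).card : ℝ) / m) * ((∑ u ∈ A, μ 0 u) * ∑ u ∈ Aᶜ, μ k.succ u) := by
  have hmpos : (0 : ℝ) < m := Nat.cast_pos.mpr (by omega)
  set e : Fin m → Fin (K + 1) × Fin (K + 1) := fun r => (((0 : Fin (K + 1)), (κ r).succ) : Fin (K + 1) × Fin (K + 1))
    with he_def
  have he : ∀ r, (e r).1 ≠ (e r).2 := fun r => (Fin.succ_ne_zero (κ r)).symm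
  set a : Fin (K + 1) → ℝ := fun i => if i = k.succ then (1 : ℝ) else 0 with ha
  set G : (Fin (K + 1) → S) → ℝ := fun x => ∑ i, a i * bottleneckTestFun (μ i) A (x i) with hG
  have hQ := ptGraphSwap_isRowStochastic (e := e) (φ := φ) hμ
  have hQrev := ptGraphSwap_detailedBalance (e := e) (φ := φ) hμ
  have hP := weightedScheme_isRowStochastic (t := t) (w := w) hQ hM hw0 hw1 ht0 ht1
  have hDB := weightedScheme_detailedBalance (w := w) hQrev hMrev t
  have hden : ∑ i, a i ^ 2 * ((∑ u ∈ A, μ i u) * ∑ u ∈ Aᶜ, μ i u) = (∑ u ∈ A, μ k.succ u) * ∑ u ∈ Aᶜ, μ k.succ u := by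
    simp_rw [ha, ite_pow, one_pow, zero_pow two_ne_zero, ite_mul, one_mul, zero_mul]
    rw [Finset.sum_ite_eq' univ k.succ, if_pos (mem_univ _)]
  have hupd : ∑ i, w i * (a i ^ 2 * edgeMeasure (μ i) (M i) A Aᶜ) = 0 := by
    simp_rw [ha, ite_pow, one_pow, zero_pow two_ne_zero, ite_mul, one_mul, zero_mul, mul_ite, mul_zero]
    rw [Finset.sum_ite_eq' univ k.succ, if_pos (mem_univ _)]; exact hidle
  have hsw := ptGraph_dirichletForm_swap_le_acc (e := e) (φ := φ) hμ he G
  have hak : ∀ i, a i = if i = k.succ then (1 : ℝ) else 0 := fun i => by rw [ha]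
  -- entry by entry: the crossing acceptance at level `k+1`, nothing elsewhere
  have hentry : ∀ r : Fin m, ∑ x : Fin (K + 1) → S,
        min (tensorFun μ x) (tensorFun μ (edgeFlowSwap (φ r) (e r).1 (e r).2 x))
          * (G x - G (edgeFlowSwap (φ r) (e r).1 (e r).2 x)) ^ 2
      ≤ if κ r = k then 2 * ((∑ u ∈ A, μ 0 u) * ∑ u ∈ Aᶜ, μ k.succ u) else 0 := by
    intro r
    have hsq : ∀ x : Fin (K + 1) → S, (G x - G (edgeFlowSwap (φ r) (e r).1 (e r).2 x)) ^ 2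
        = (a (e r).1 - a (e r).2) ^ 2
          * ((if x (e r).1 ∈ A then (0 : ℝ) else 1) - (if x (e r).2 ∈ A then (0 : ℝ) else 1)) ^ 2 := by
      intro x
      rw [hG]
      simp only
      rw [graphProfileCount_sub_swap hμ1 a (hφA r) (he r) x, mul_pow]
    simp_rw [hsq]
    have h1 : (e r).1 = 0 := rfl
    have h2 : (e r).2 = (κ r).succ := rfl
    have ha1 : a (e r).1 = 0 := by rw [hak, h1, if_neg (Fin.succ_ne_zero k).symm]
    by_cases hr : κ r = k
    · have ha2 : a (e r).2 = 1 := by rw [hak, h2, hr, if_pos rfl]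
      rw [if_pos hr, ha1, ha2]
      have e1 : ∀ x : Fin (K + 1) → S, min (tensorFun μ x) (tensorFun μ (edgeFlowSwap (φ r) (e r).1 (e r).2 x))
          * (((0 : ℝ) - 1) ^ 2 * ((if x (e r).1 ∈ A then (0 : ℝ) else 1) - (if x (e r).2 ∈ A then (0 : ℝ) else 1)) ^ 2)
          = min (tensorFun μ x) (tensorFun μ (edgeFlowSwap (φ r) (e r).1 (e r).2 x))
          * ((if x (e r).1 ∈ A then (0 : ℝ) else 1) - (if x (e r).2 ∈ A then (0 : ℝ) else 1)) ^ 2 := by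
        intro x; ring
      simp_rw [e1]
      have h := crossingAcceptance_le (μ := μ) hμ hμ1 (hφA r) (he r)
      rw [h1, h2, hr] at h
      rw [h1, h2, hr]
      exact h
    · have ha2 : a (e r).2 = 0 := by
        rw [hak, h2, if_neg (fun h => hr (Fin.succ_injective _ h))]
      rw [if_neg hr, ha1, ha2]
      refine Finset.sum_nonpos fun x _ => ?_
      have : ((0 : ℝ) - 0) ^ 2 * ((if x (e r).1 ∈ A then (0 : ℝ) else 1) - (if x (e r).2 ∈ A then (0 : ℝ) else 1)) ^ 2 = 0 := by
        ring
      rw [this, mul_zero]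
  have hsum : ∑ r : Fin m, ∑ x : Fin (K + 1) → S,
        min (tensorFun μ x) (tensorFun μ (edgeFlowSwap (φ r) (e r).1 (e r).2 x))
          * (G x - G (edgeFlowSwap (φ r) (e r).1 (e r).2 x)) ^ 2
      ≤ ((univ.filter (fun r : Fin m => κ r = k)).card : ℝ) * (2 * ((∑ u ∈ A, μ 0 u) * ∑ u ∈ Aᶜ, μ k.succ u)) := by
    refine (sum_le_sum fun r _ => hentry r).trans ?_
    rw [Finset.sum_ite, Finset.sum_const_zero, add_zero, sum_const, nsmul_eq_mul]
  rw [weightedScheme_dirichletForm (Q := ptGraphSwap μ e φ) (w := w) (M := M),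
    prodKernel_dirichletForm_profileCount hμ1 hM hMrev w a A, hupd, mul_zero, add_zero]
  calc t * dirichletForm (tensorFun μ) (ptGraphSwap μ e φ) G
      ≤ t * (1 / (2 * m) * (((univ.filter (fun r : Fin m => κ r = k)).card : ℝ) * (2 * ((∑ u ∈ A, μ 0 u) * ∑ u ∈ Aᶜ, μ k.succ u)))) :=
        mul_le_mul_of_nonneg_left (hsw.trans (mul_le_mul_of_nonneg_left hsum (by positivity))) ht0
    _ = t * (((univ.filter (fun r : Fin m => κ r = k)).card : ℝ) / m) * ((∑ u ∈ A, μ 0 u) * ∑ u ∈ Aᶜ, μ k.succ u) := by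
        field_simp

/-- **THE SECTOR INDICATOR IS SLOW BY NAME: `τ_int(g_k) = v(g_k)/(2Var g_k) ≥ m·μ_{k+1}(A)/(t·c_k·μ_0(A)) − ½`** (irreducible scheme, reversible kernels,
level `k+1` sector-idle with `μ_{k+1}(A)μ_{k+1}(Aᶜ) > 0`, `t·c_k·μ_0(A) > 0`, `|S| ≥ 2`). [ours] -/
theorem sectorProfile_tauInt_ge [Nontrivial S] (hm : 1 ≤ m) (hμ : ∀ k x, 0 < μ k x) (hμ1 : ∀ k, ∑ u, μ k u = 1)
    (hM : ∀ k, IsRowStochastic (M k)) (hMrev : ∀ k, DetailedBalance (μ k) (M k)) (hw0 : ∀ k, 0 ≤ w k) (hw1 : ∑ k, w k = 1)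
    (ht0 : 0 < t) (ht1 : t ≤ 1) {A : Finset S} (hφA : ∀ r u, φ r u ∈ A ↔ u ∈ A) (k : Fin K)
    (hAk : 0 < (∑ u ∈ A, μ k.succ u) * ∑ u ∈ Aᶜ, μ k.succ u) (hck : 1 ≤ (univ.filter (fun r : Fin m => κ r = k)).card)
    (hidle : w k.succ * edgeMeasure (μ k.succ) (M k.succ) A Aᶜ = 0)
    (hirr : Literature.Probability.MarkovChains.IsIrreducible (fun y z : Fin (K + 1) → S =>
        t * ptGraphSwap μ (fun r : Fin m => (((0 : Fin (K + 1)), (κ r).succ) : Fin (K + 1) × Fin (K + 1))) φ y z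
          + (1 - t) * prodKernel w M y z)) :
    m * (∑ u ∈ A, μ k.succ u) / (t * ((univ.filter (fun r : Fin m => κ r = k)).card : ℝ) * ∑ u ∈ A, μ 0 u) - 1 / 2
      ≤ asympVar (fun x : Fin (K + 1) → S => ∑ i, (if i = k.succ then (1 : ℝ) else 0) * bottleneckTestFun (μ i) A (x i)) (tensorFun μ)
          (fun y z : Fin (K + 1) → S =>
            t * ptGraphSwap μ (fun r : Fin m => (((0 : Fin (K + 1)), (κ r).succ) : Fin (K + 1) × Fin (K + 1))) φ y z
              + (1 - t) * prodKernel w M y z)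
        / (2 * lawVariance (tensorFun μ) (fun x : Fin (K + 1) → S => ∑ i, (if i = k.succ then (1 : ℝ) else 0) * bottleneckTestFun (μ i) A (x i))) := by
  have hmpos : (0 : ℝ) < m := Nat.cast_pos.mpr (by omega)
  have hckpos : (0 : ℝ) < ((univ.filter (fun r : Fin m => κ r = k)).card : ℝ) := Nat.cast_pos.mpr (by omega)
  have hA0 : 0 < ∑ u ∈ A, μ 0 u := by
    have hAne : A.Nonempty := by
      by_contra h
      rw [Finset.not_nonempty_iff_eq_empty] at h
      rw [h, Finset.sum_empty, zero_mul] at hAk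
      exact lt_irrefl _ hAk
    exact Finset.sum_pos (fun u _ => hμ 0 u) hAne
  set e : Fin m → Fin (K + 1) × Fin (K + 1) := fun r => (((0 : Fin (K + 1)), (κ r).succ) : Fin (K + 1) × Fin (K + 1)) with he_def
  set P : (Fin (K + 1) → S) → (Fin (K + 1) → S) → ℝ := fun y z => t * ptGraphSwap μ e φ y z + (1 - t) * prodKernel w M y z with hPdef
  set g : (Fin (K + 1) → S) → ℝ := fun x => ∑ i, (if i = k.succ then (1 : ℝ) else 0) * bottleneckTestFun (μ i) A (x i) with hgdef
  have hP : IsRowStochastic P :=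
    weightedScheme_isRowStochastic (t := t) (w := w) (ptGraphSwap_isRowStochastic (e := e) (φ := φ) hμ) hM hw0 hw1 ht0.le ht1
  have hDB : DetailedBalance (tensorFun μ) P := weightedScheme_detailedBalance (w := w) (ptGraphSwap_detailedBalance (e := e) (φ := φ) hμ) hMrev t
  have hst : IsStationary (tensorFun μ) P := hDB.isStationary hP.2
  have hπ := tensorFun_pos hμ
  have hπ1 := sum_tensorFun_eq_one μ hμ1
  -- variance and lag-one autocovariance of `g`
  have hmean : lawMean (tensorFun μ) g = 0 := ptBare_mean_profileCount (μ := μ) hμ1 _ A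
  have hvar : lawVariance (tensorFun μ) g = (∑ u ∈ A, μ k.succ u) * ∑ u ∈ Aᶜ, μ k.succ u := by
    rw [← piInner_centred_eq_lawVariance, hmean]
    simp only [sub_zero]
    rw [ptBare_piInner_profileCount hμ1 _ A]
    simp_rw [ite_pow, one_pow, zero_pow two_ne_zero, ite_mul, one_mul, zero_mul]
    rw [Finset.sum_ite_eq' univ k.succ, if_pos (mem_univ _)]
  have hvarpos : 0 < lawVariance (tensorFun μ) g := by rw [hvar]; exact hAk
  -- `C(0) − C(1) = 𝓔_P(g) ≤ t(c_k/m)μ_0(A)μ(Aᶜ)`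
  have hE := sectorProfile_dirichletForm_le κ φ hm hμ hμ1 hM hMrev hw0 hw1 ht0.le ht1 hφA k hidle
  have h928 := MadrasSlade1993_eq_9_2_28 hP hst g
  have hprop := MadrasSlade1993_prop_9_2_2 hπ hπ1 hP hDB hirr hvarpos
  -- abbreviations
  set C0 := lawVariance (tensorFun μ) g with hC0
  set C1 := piInner (tensorFun μ) (centred (tensorFun μ) g) (P *ᵥ centred (tensorFun μ) g) with hC1
  set D := dirichletForm (tensorFun μ) P g with hDdef
  have hD : C0 - C1 = D := h928
  have hDpos : 0 < D := by
    -- from Prop 9.2.2's proof shape: `D = 0` contradicts `C0 > 0` (the ratio would blow up); use `D ≤ bound` only needs `D > 0` for division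
    by_contra hD0
    have hDnn : 0 ≤ D := dirichletForm_nonneg (fun x => (hπ x).le) hP.1 g
    have hDz : D = 0 := le_antisymm (not_lt.mp hD0) hDnn
    -- then `C1 = C0` and the left side of Prop 9.2.2 is `(1+1)/(1−1)·C0`: Lean's `x/0 = 0`, so it reads `0 ≤ v`; we need another route:
    -- an irreducible chain has `Gap > 0`, hence `D ≥ Gap·C0 > 0`
    have hgap : 0 < spectralGap (tensorFun μ) P := spectralGap_pos hπ hπ1 hP hDB hirr
    have hray := LevinPeres2017_remark_13_8 hπ hπ1 hP hDB g
    have : 0 < D := lt_of_lt_of_le (mul_pos hgap hvarpos) hray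
    linarith
  -- Prop 9.2.2: `((1+ρ)/(1−ρ))·C0 ≤ v` with `ρ = C1/C0`, i.e. `v/(2C0) ≥ (C0 + C1)/(2D) = C0/D − 1/2`
  have hρ : 1 - C1 / C0 = D / C0 := by rw [← hD]; field_simp
  have hρ' : 1 + C1 / C0 = (2 * C0 - D) / C0 := by rw [← hD]; field_simp; ring
  rw [hρ, hρ'] at hprop
  have hv : (2 * C0 - D) / D * C0 ≤ asympVar g (tensorFun μ) P := by
    have e1 : (2 * C0 - D) / C0 / (D / C0) * C0 = (2 * C0 - D) / D * C0 := by field_simp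
    rw [e1] at hprop; exact hprop
  -- conclude: `v/(2C0) ≥ (2C0 − D)/(2D) = C0/D − 1/2 ≥ C0/bound − 1/2`
  rw [le_div_iff₀ (by positivity : (0 : ℝ) < 2 * C0)]
  have hbound : C0 / (t * (((univ.filter (fun r : Fin m => κ r = k)).card : ℝ) / m) * ((∑ u ∈ A, μ 0 u) * ∑ u ∈ Aᶜ, μ k.succ u))
      ≤ C0 / D := div_le_div_of_nonneg_left hvarpos.le hDpos hE
  have hAc : 0 < ∑ u ∈ Aᶜ, μ k.succ u := by
    rcases (mul_pos_iff.mp hAk) with ⟨_, h⟩ | ⟨h1, _⟩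
    · exact h
    · exact absurd h1 (not_lt.mpr (sum_nonneg fun u _ => (hμ _ u).le))
  have e2 : C0 / (t * (((univ.filter (fun r : Fin m => κ r = k)).card : ℝ) / m) * ((∑ u ∈ A, μ 0 u) * ∑ u ∈ Aᶜ, μ k.succ u))
      = m * (∑ u ∈ A, μ k.succ u) / (t * ((univ.filter (fun r : Fin m => κ r = k)).card : ℝ) * ∑ u ∈ A, μ 0 u) := by
    rw [hvar]; field_simp
  rw [e2] at hbound
  have e3 : (2 * C0 - D) / D * C0 = (C0 / D - 1 / 2) * (2 * C0) := by field_simp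
  rw [e3] at hv
  calc (m * (∑ u ∈ A, μ k.succ u) / (t * ((univ.filter (fun r : Fin m => κ r = k)).card : ℝ) * ∑ u ∈ A, μ 0 u) - 1 / 2) * (2 * C0)
      ≤ (C0 / D - 1 / 2) * (2 * C0) := mul_le_mul_of_nonneg_right (by linarith) (by positivity)
    _ ≤ asympVar g (tensorFun μ) P := hv

/-- **At a tight sector the sector indicator has `τ_int ≥ m/(t·c_k·p') − ½`** (`μ_j(A) = θ ∈ (0,1)` for `j ≠ 0`, `μ_0(A) ≤ p'θ`; hypotheses as above). [ours] -/
theorem tightSector_sectorProfile_tauInt_ge [Nontrivial S] (hm : 1 ≤ m) (hμ : ∀ k x, 0 < μ k x) (hμ1 : ∀ k, ∑ u, μ k u = 1)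
    (hM : ∀ k, IsRowStochastic (M k)) (hMrev : ∀ k, DetailedBalance (μ k) (M k)) (hw0 : ∀ k, 0 ≤ w k) (hw1 : ∑ k, w k = 1)
    (ht0 : 0 < t) (ht1 : t ≤ 1) {A : Finset S} (hφA : ∀ r u, φ r u ∈ A ↔ u ∈ A) {θ p' : ℝ} (hθ0 : 0 < θ) (hθ1 : θ < 1)
    (hcold : ∀ j : Fin (K + 1), j ≠ 0 → ∑ u ∈ A, μ j u = θ) (hhot : ∑ u ∈ A, μ 0 u ≤ p' * θ) (k : Fin K)
    (hck : 1 ≤ (univ.filter (fun r : Fin m => κ r = k)).card) (hidle : w k.succ * edgeMeasure (μ k.succ) (M k.succ) A Aᶜ = 0)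
    (hirr : Literature.Probability.MarkovChains.IsIrreducible (fun y z : Fin (K + 1) → S =>
        t * ptGraphSwap μ (fun r : Fin m => (((0 : Fin (K + 1)), (κ r).succ) : Fin (K + 1) × Fin (K + 1))) φ y z
          + (1 - t) * prodKernel w M y z)) :
    m / (t * ((univ.filter (fun r : Fin m => κ r = k)).card : ℝ) * p') - 1 / 2
      ≤ asympVar (fun x : Fin (K + 1) → S => ∑ i, (if i = k.succ then (1 : ℝ) else 0) * bottleneckTestFun (μ i) A (x i)) (tensorFun μ)
          (fun y z : Fin (K + 1) → S =>
            t * ptGraphSwap μ (fun r : Fin m => (((0 : Fin (K + 1)), (κ r).succ) : Fin (K + 1) × Fin (K + 1))) φ y z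
              + (1 - t) * prodKernel w M y z)
        / (2 * lawVariance (tensorFun μ) (fun x : Fin (K + 1) → S => ∑ i, (if i = k.succ then (1 : ℝ) else 0) * bottleneckTestFun (μ i) A (x i))) := by
  have hmpos : (0 : ℝ) < m := Nat.cast_pos.mpr (by omega)
  have hckpos : (0 : ℝ) < ((univ.filter (fun r : Fin m => κ r = k)).card : ℝ) := Nat.cast_pos.mpr (by omega)
  have h1θ : 0 < 1 - θ := by linarith
  have hAk : 0 < (∑ u ∈ A, μ k.succ u) * ∑ u ∈ Aᶜ, μ k.succ u := by
    rw [tightSector_coldBalance_eq hμ1 hcold k.succ (Fin.succ_ne_zero k)]; exact mul_pos hθ0 h1θ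
  have h := sectorProfile_tauInt_ge κ φ hm hμ hμ1 hM hMrev hw0 hw1 ht0 ht1 hφA k hAk hck hidle hirr
  refine le_trans ?_ h
  rw [hcold k.succ (Fin.succ_ne_zero k)]
  have hA0 : 0 < ∑ u ∈ A, μ 0 u := by
    have hAne : A.Nonempty := by
      by_contra hne; rw [Finset.not_nonempty_iff_eq_empty] at hne
      have := hcold k.succ (Fin.succ_ne_zero k); rw [hne, Finset.sum_empty] at this; linarith
    exact Finset.sum_pos (fun u _ => hμ 0 u) hAne
  have hp'0 : 0 < p' := by
    have : 0 < p' * θ := lt_of_lt_of_le hA0 hhot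
    nlinarith
  -- `m/(t c p') ≤ m θ/(t c μ_0(A))` since `μ_0(A) ≤ p'θ`
  have key : (m : ℝ) / (t * ((univ.filter (fun r : Fin m => κ r = k)).card : ℝ) * p')
      ≤ m * θ / (t * ((univ.filter (fun r : Fin m => κ r = k)).card : ℝ) * ∑ u ∈ A, μ 0 u) := by
    rw [div_le_div_iff₀ (by positivity) (by positivity)]
    have := mul_le_mul_of_nonneg_left hhot (by positivity : (0 : ℝ) ≤ m * (t * ((univ.filter (fun r : Fin m => κ r = k)).card : ℝ)))
    nlinarith [this]
  linarith

/-- **Two-sided for the named observable:** exact hot redraws, one-sided domination `p ∈ (0,1]`, multiplicities `≥ c ≥ 1`, `0 < t < 1`, `w_0 > 0`, tight sector: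
`m/(t·c_k·p') − ½ ≤ τ_int(g_k) ≤ 1/(p·min{ct/(3m),(1−t)w_0/(7K)}) − ½` (`Scaling/DominatedStarRegimeFreeAutocorrelation` for the ceiling). [ours] -/
theorem dominatedStar_sectorProfile_tauInt_two_sided [Nontrivial S] (hK : 1 ≤ K) (hm : 1 ≤ m) (ht0 : 0 < t) (ht1 : t < 1)
    (hw0 : ∀ k, 0 ≤ w k) (hw00 : 0 < w 0) (hw1 : ∑ k, w k = 1) (hμ : ∀ k x, 0 < μ k x)
    (hμ1 : ∀ k, ∑ u, μ k u = 1) (hM : ∀ k, IsRowStochastic (M k)) (hMrev : ∀ k, DetailedBalance (μ k) (M k))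
    (hM0 : ∀ u v, M 0 u v = μ 0 v) (hp0 : 0 < p) (hp1 : p ≤ 1) (hdom : ∀ r u, p * μ (κ r).succ (φ r u) ≤ μ 0 u)
    {c : ℕ} (hc1 : 1 ≤ c) (hc : ∀ p' : Fin K, c ≤ (univ.filter (fun r : Fin m => κ r = p')).card)
    {A : Finset S} (hφA : ∀ r u, φ r u ∈ A ↔ u ∈ A) {θ p' : ℝ} (hθ0 : 0 < θ) (hθ1 : θ < 1)
    (hcold : ∀ j : Fin (K + 1), j ≠ 0 → ∑ u ∈ A, μ j u = θ) (hhot : ∑ u ∈ A, μ 0 u ≤ p' * θ) (k : Fin K)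
    (hidle : w k.succ * edgeMeasure (μ k.succ) (M k.succ) A Aᶜ = 0) :
    m / (t * ((univ.filter (fun r : Fin m => κ r = k)).card : ℝ) * p') - 1 / 2
      ≤ asympVar (fun x : Fin (K + 1) → S => ∑ i, (if i = k.succ then (1 : ℝ) else 0) * bottleneckTestFun (μ i) A (x i)) (tensorFun μ)
          (fun y z : Fin (K + 1) → S =>
            t * ptGraphSwap μ (fun r : Fin m => (((0 : Fin (K + 1)), (κ r).succ) : Fin (K + 1) × Fin (K + 1))) φ y z
              + (1 - t) * prodKernel w M y z)
        / (2 * lawVariance (tensorFun μ) (fun x : Fin (K + 1) → S => ∑ i, (if i = k.succ then (1 : ℝ) else 0) * bottleneckTestFun (μ i) A (x i)))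
    ∧ asympVar (fun x : Fin (K + 1) → S => ∑ i, (if i = k.succ then (1 : ℝ) else 0) * bottleneckTestFun (μ i) A (x i)) (tensorFun μ)
          (fun y z : Fin (K + 1) → S =>
            t * ptGraphSwap μ (fun r : Fin m => (((0 : Fin (K + 1)), (κ r).succ) : Fin (K + 1) × Fin (K + 1))) φ y z
              + (1 - t) * prodKernel w M y z)
        / (2 * lawVariance (tensorFun μ) (fun x : Fin (K + 1) → S => ∑ i, (if i = k.succ then (1 : ℝ) else 0) * bottleneckTestFun (μ i) A (x i)))
      ≤ 1 / (p * min (c * t / (3 * m)) ((1 - t) * w 0 / (7 * K))) - 1 / 2 := by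
  have hirr := dominatedStar_isIrreducible_regimeFree κ φ ht0 ht1 hw0 hw00 hw1 hμ hM hM0 hc1 hc
  have h1θ : 0 < 1 - θ := by linarith
  have hvar : 0 < lawVariance (tensorFun μ) (fun x : Fin (K + 1) → S => ∑ i, (if i = k.succ then (1 : ℝ) else 0) * bottleneckTestFun (μ i) A (x i)) := by
    rw [← piInner_centred_eq_lawVariance, show lawMean (tensorFun μ)
        (fun x : Fin (K + 1) → S => ∑ i, (if i = k.succ then (1 : ℝ) else 0) * bottleneckTestFun (μ i) A (x i)) = 0 from
      ptBare_mean_profileCount (μ := μ) hμ1 _ A]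
    simp only [sub_zero]
    rw [ptBare_piInner_profileCount hμ1 _ A]
    simp_rw [ite_pow, one_pow, zero_pow two_ne_zero, ite_mul, one_mul, zero_mul]
    rw [Finset.sum_ite_eq' univ k.succ, if_pos (mem_univ _), tightSector_coldBalance_eq hμ1 hcold k.succ (Fin.succ_ne_zero k)]
    exact mul_pos hθ0 h1θ
  exact ⟨tightSector_sectorProfile_tauInt_ge κ φ hm hμ hμ1 hM hMrev hw0 hw1 ht0 ht1.le hφA hθ0 hθ1 hcold hhot k (hc1.trans (hc k)) hidle hirr,
    dominatedStar_tauInt_le_regimeFree κ φ hK hm ht0 ht1 hw0 hw00 hw1 hμ hμ1 hM hMrev hM0 hp0 hp1 hdom hc1 hc hvar⟩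

end Star

end Summit.Ventures.LatticeQCDFlow.Scaling

end
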